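import Summits.CriticalPhenomena.Ising3D.Control2DL11BoxD
import Summits.CriticalPhenomena.Ising3D.Control2DL11BoxE
import Summits.CriticalPhenomena.Ising3D.Control2DL11BoxF
import Summits.CriticalPhenomena.Ising3D.Control2DL11BoxG
import Summits.CriticalPhenomena.Ising3D.Control2DGammaL7Eps1005
import Mathlib.Tactic.NormNum
import HarnessLib

/-!
# The first KERNEL-COMPLETE two-sided 2D control statement: `0.86 < Δ_ε < 1.005` at `Δ_σ = 1/8` under `A2D′` (window `Δ_ε ≥ 0.4`)
(cell `pub-ising3x`, seat controls-1 gen 16; KERNEL PATH for the 2D γ-certificates, Λ = 11 class-1 cover — CONTROL-ONLY)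

HONEST FRAMING: lottery ticket; floor = tightest certified 3D Ising CFT bounds; no exact-solution
claim without a proof. CONTROL-ONLY: `d = 2`, global blocks, `Δ_σ = 1/8` exact, the 2D axiom set `A2D′`
(the `σ × σ` scalars are the `ε` location `x` plus `[2, ∞)`; stress tensor at `(2,2)` plus a spin-2 gap `1`;
unitarity). This validates the class-1 (two-sided) certificate PIPELINE of the 2D control down to the Lean
kernel on the exactly solved 2D Ising model (`Δ_ε = 1`); nothing about `d = 3`, and weaker than the cell's
reader-certified statement of record (`0.99 < Δ_ε < 1.00005`, no window; RB-7, Λ = 19 — readers A ∧ B, not kernel).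

* `excludedOn_2d_L11_cover : ExcludedOn (1/8) 2 1 (Icc (2/5) (43/50))` — the four kernel-complete Λ = 11 kind-`box`
  certificates D `[2/5, 11/20]`, E `[11/20, 7/10]`, F `[7/10, 4/5]`, G `[4/5, 43/50]` chained by `excludedOn_Icc_append`;
* `twoSided_2d_L11_kernel : TwoSided (1/8) 2 1 (2/5) (43/50) (201/200)` — with the kernel-complete gap certificate
  `gapExcluded_2d_gamma_L7_e1005 : GapExcluded (1/8) (201/200)` (g15) via `twoSided_of_cover` (`Control2DIsland`):
  every `A2D′` datum at `Δ_σ = 1/8` whose `ε` location `x` is `≥ 2/5` has `43/50 < x < 201/200`.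
Every inequality behind it ((I), (R) and all cells of five derivative functionals) is re-decided by the Lean kernel;
zero grant compute. Successor: boxes B, C (`[37/100, 2/5]`) and H, I, J (`[43/50, 181/200]`) of the same RB-2 chain
(generator HOME/code/controls/kp3/gen_cert.py; literal library `Nd = 47, 55` landed/landing) widen this to the
reader-certified Λ = 11 window `[0.37, 0.905]`. No facts, standard axioms only.
-/

namespace Summit.CriticalPhenomena.Ising3D.Control2D

open Set
open Literature.MathematicalPhysics.QuantumFieldTheory.ConformalBootstrap3D

/-- **Kernel-complete cover of the `ε` locations `[2/5, 43/50]`** at `Δ_σ = 1/8` under `A2D′` (boxes D, E, F, G of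
the RB-2 Λ = 11 chain, each `excludedOn_2d_L11_box·` kernel-complete). CONTROL-ONLY (d = 2). [cite: RattazziEtAl2008, §5.5] -/
theorem excludedOn_2d_L11_cover : ExcludedOn (1 / 8 : ℝ) 2 1 (Icc (2 / 5 : ℝ) (43 / 50)) :=
  excludedOn_Icc_append
    (excludedOn_Icc_append (excludedOn_Icc_append excludedOn_2d_L11_boxD excludedOn_2d_L11_boxE le_rfl)
      excludedOn_2d_L11_boxF le_rfl)
    excludedOn_2d_L11_boxG le_rfl

/-- **2D control, class 1 (two-sided), KERNEL-COMPLETE**: in every parity-symmetric unitary solution of the 2D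
`⟨σσσσ⟩` sum rule at `Δ_σ = 1/8` satisfying `A2D′` whose `ε` location `x` is at least `2/5`, one has
`43/50 < x < 201/200` — i.e. `0.86 < Δ_ε < 1.005` (the 2D Ising value is `Δ_ε = 1`). From the kernel-complete box
cover `excludedOn_2d_L11_cover` and the kernel-complete gap certificate `gapExcluded_2d_gamma_L7_e1005`.
CONTROL-ONLY (d = 2). [cite: RattazziEtAl2008, §5.5] -/
theorem twoSided_2d_L11_kernel : TwoSided (1 / 8 : ℝ) 2 1 (2 / 5) (43 / 50) (201 / 200) :=
  twoSided_of_cover excludedOn_2d_L11_cover gapExcluded_2d_gamma_L7_e1005 (by norm_num)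

end Summit.CriticalPhenomena.Ising3D.Control2D
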